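import Summits.Ventures.YMGap.Thresholds.StarLimitLipschitz
import Summits.Ventures.YMGap.Thresholds.StarFrontLemmaG
import Summits.Ventures.YMGap.StrongCouplingGapShape
import Literature.MathematicalPhysics.QuantumLattice.LatticeGaugeDLRLimitPointsProofs
import Literature.MathematicalPhysics.QuantumFieldTheory.LatticeGaugeShenZhuZhuProofs
import HarnessLib

/-!
# Venture YMGap — track (c) «DS»: the Shen–Zhu–Zhu-shaped clustering clause for every infinite-volume
# limit state of `SU(2)` lattice Yang–Mills (`d = 4`), and `MassGapAt 4 2 β` given DLR uniqueness —
# kernel-checked given the star window bound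

HONEST FRAMING: venture file (cell `pub-ymgap`, PLAN R99/R101–R103), strong-coupling LATTICE statement
only.  INPUT: the hypothesis schema `StarWindowBound L β_W ρ r` of `StarWindow.lean` on all large tori
with ONE received sum `ρ < 1` (ds-4's `starWindowBound_lemmaG` discharges it for `β_W ≤ 1/2` with
`ρ = R_G(β_W)`, `R_G < 1` iff `β_W < 0.3609…`; not this file), and — for the `MassGapAt` capstone only —
uniqueness of the DLR state (`HasUniqueGibbsMeasure`, route X of the cell, ds-3/ds-1; an explicit
hypothesis here).  OUTPUT, kernel-checked GIVEN those inputs: for every infinite-volume limit state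
`μ ∈ infiniteVolumeLimitPoints (d := 4) (fundamentalRep (Fin 2)) (β_W/2)` and every `n`, ONE constant
`c₁ = 32 n² e^{3κ}` with `|cov_μ(F₁, F₂)| ≤ c₁ e^{−κ(ρ) d(Λ₁, Λ₂)} (K₁K₂ + ‖F₁‖₂‖F₂‖₂)` for all Lipschitz
cylinder functions `Fᵢ` (`IsLipschitzCylinder`, supports `Λᵢ` of size `≤ n`) — VERBATIM clause (ii) of
`Summit.Ventures.YMGap.MassGapAt 4 2 β` (the track-(a) currency of `StrongCouplingGapShape.lean`, i.e.
the `β`-body of the tree's `shen_zhu_zhu`) restricted to limit states; and `MassGapAt 4 2 β` itself at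
't Hooft coupling `β` (Wilson `β_W = 4β`) once the DLR state is unique.  What this file does NOT say:
uniqueness (taken as a hypothesis), anything at couplings where `StarWindowBound` is not supplied,
anything about the continuum, confinement or a transfer-matrix gap.

Method (all inputs are tree theorems).  Lipschitz cylinder functions read through the periodic lift
are admissible link observables of the torus (`linkObs_toTorusObservable`, per-link constant `K` for
the Frobenius weight, once `torusEdge L` is injective on the support), so ds-1's star door
`DSWindow.su2Star_abs_covariance_le` bounds the torus covariance by
`4(2√2)² e^{−κ L₀} (#Λ₁ K₁)(#Λ₂ K₂)` with `L₀ ≥ d(Λ₁, Λ₂) − 3` (no separation needed); Lipschitz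
cylinders are continuous, so the bound passes to every limit state along its defining subsequence
(`abs_cov_le_of_eventually_torus`).  The `MassGapAt` capstone: the unique DLR state is a limit point
(`infiniteVolumeLimitPoints_nonempty_holds`, `mem_ymGibbsMeasures_of_mem_infiniteVolumeLimitPoints_holds`).

References: cell files `LIMIT-STATES.md` (ds-2), `UNIQUENESS-K-SCOPE.md` (ds-3), `LEAN-KROW.md`
(ds-1); H. Shen, R. Zhu, X. Zhu, CMP 400 (2023) Thm 1.2 / Cor 1.4 (the clause shape); Föllmer, LNM 1362
(1988) Ch. I Thm. (2.13); Dobrushin–Shlosman (1985); Georgii (2011) Thm. 4.17.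
-/

noncomputable section

open MeasureTheory ProbabilityTheory Function Finset Filter Topology
open scoped NNReal
open Literature.Probability.LatticeModels
open Literature.Probability.LatticeModels.DobrushinMetric
open Literature.MathematicalPhysics.QuantumLattice (toTorusObservable toTorusObservable_apply IsCylinder
  LGConfig torusLift torusEdge fundamentalRep infiniteVolumeLimitPoints IsInfiniteVolumeLimitAlong
  ymSpecification ymGibbsMeasures continuous_fundamentalRep
  mem_ymGibbsMeasures_of_mem_infiniteVolumeLimitPoints_holds infiniteVolumeLimitPoints_nonempty_holds)
open Literature.MathematicalPhysics.QuantumFieldTheory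
open Literature.MathematicalPhysics.QuantumFieldTheory.Balaban1983to89
open Literature.MathematicalPhysics.QuantumFieldTheory.Balaban1983to89.StrongCouplingTorusWindow
open Summit.Ventures.YMGap.DSWindow
open Summit.Ventures.YMGap.StarWindowGauge (gaugeR)

namespace Summit.Ventures.YMGap.StarLimit

/-! ### The Shen–Zhu–Zhu-shaped clustering clause for limit states -/

section Limit

/-- `setDistEdges` is at most the sup-distance of any pair of base points. -/
theorem setDistEdges_le_supNorm {Λ₁ Λ₂ : Finset (Literature.MathematicalPhysics.QuantumLattice.ZdEdge 4)}
    {a b : Literature.MathematicalPhysics.QuantumLattice.ZdEdge 4} (ha : a ∈ Λ₁) (hb : b ∈ Λ₂) :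
    setDistEdges Λ₁ Λ₂ ≤ (Literature.Probability.LatticeModels.Site.supNorm (a.1 - b.1) : ℝ) := by
  have hne : (Λ₁ ×ˢ Λ₂).Nonempty := ⟨(a, b), Finset.mk_mem_product ha hb⟩
  unfold setDistEdges
  rw [dif_pos hne, ← Literature.Probability.LatticeModels.Site.norm_eq_supNorm]
  exact Finset.inf'_le (fun p : Literature.MathematicalPhysics.QuantumLattice.ZdEdge 4 ×
      Literature.MathematicalPhysics.QuantumLattice.ZdEdge 4 => ‖p.1.1 - p.2.1‖)
    (Finset.mk_mem_product ha hb)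

/-- **The Shen–Zhu–Zhu-shaped clustering clause for every infinite-volume limit state, from the star
window bound** (`SU(2)`, `d = 4`, Wilson coupling `β_W`): if every torus of side `L ≥ L₁` carries
`StarWindowBound L β_W ρ suFrobDist` with `ρ < 1`, then for every limit state
`μ ∈ infiniteVolumeLimitPoints (d := 4) (fundamentalRep (Fin 2)) (β_W/2)` and every `n`, with
`c₁ = 4(2√2)² n² e^{3κ(ρ)}`: for all Lipschitz cylinder functions `F₁, F₂` with supports `Λ₁, Λ₂`
of size `≤ n`, `|cov_μ(F₁, F₂)| ≤ c₁ e^{−κ(ρ) d(Λ₁,Λ₂)} (K₁K₂ + ‖F₁‖₂‖F₂‖₂)` — literally the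
covariance clause of `Summit.Ventures.YMGap.MassGapAt` / the tree's `shen_zhu_zhu` at this coupling,
for limit states. -/
theorem su2Star_limitState_clustering (βW : ℝ) {ρ : ℝ} (hρ0 : 0 ≤ ρ) (hρ1 : ρ < 1) (L₁ : ℕ)
    (hS : ∀ (L : ℕ) [NeZero L], L₁ ≤ L → StarWindowBound L βW ρ suFrobDist) :
    ∀ μ ∈ infiniteVolumeLimitPoints (d := 4) (fundamentalRep (Fin 2)) (βW / 2), ∀ n : ℕ, ∃ c₁ : ℝ,
      ∀ (F₁ F₂ : LGConfig 4 (Matrix.specialUnitaryGroup (Fin 2) ℂ) → ℝ)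
        (Λ₁ Λ₂ : Finset (Literature.MathematicalPhysics.QuantumLattice.ZdEdge 4)) (K₁ K₂ : ℝ≥0),
        Λ₁.card ≤ n → Λ₂.card ≤ n → Disjoint Λ₁ Λ₂ →
        IsLipschitzCylinder (fundamentalRep (Fin 2)) F₁ Λ₁ K₁ →
        IsLipschitzCylinder (fundamentalRep (Fin 2)) F₂ Λ₂ K₂ →
          |cov[F₁, F₂; μ]| ≤ c₁ * Real.exp (-starRate ρ * setDistEdges Λ₁ Λ₂) *
            ((K₁ : ℝ) * K₂ + Real.sqrt (∫ U, F₁ U ^ 2 ∂μ) * Real.sqrt (∫ U, F₂ U ^ 2 ∂μ)) := by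
  classical
  intro μ hμ n
  haveI : SecondCountableTopology (Matrix (Fin 2) (Fin 2) ℂ) :=
    inferInstanceAs (SecondCountableTopology (Fin 2 → Fin 2 → ℂ))
  haveI : SecondCountableTopology (Matrix.specialUnitaryGroup (Fin 2) ℂ) :=
    Topology.IsEmbedding.subtypeVal.secondCountableTopology
  obtain ⟨Lseq, hLmono, hμL⟩ := hμ
  haveI := hμL.1
  have hκ0 : 0 < starRate ρ := starRate_pos hρ0 hρ1
  refine ⟨4 * (2 * Real.sqrt 2) ^ 2 * (n : ℝ) ^ 2 * Real.exp (3 * starRate ρ), ?_⟩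
  intro F₁ F₂ Λ₁ Λ₂ K₁ K₂ h₁ h₂ _ hF₁ hF₂
  have hK₁ : (0 : ℝ) ≤ K₁ := K₁.2
  have hK₂ : (0 : ℝ) ≤ K₂ := K₂.2
  -- the distance scale and the torus threshold
  set m : ℕ := ⌊setDistEdges Λ₁ Λ₂⌋₊ with hm
  set Dmax : ℕ := ((Λ₁ ∪ Λ₂) ×ˢ (Λ₁ ∪ Λ₂)).sup fun ab =>
    Literature.Probability.LatticeModels.Site.supNorm (ab.1.1 - ab.2.1) with hDmax
  have hDm : ∀ a ∈ Λ₁ ∪ Λ₂, ∀ b ∈ Λ₁ ∪ Λ₂,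
      Literature.Probability.LatticeModels.Site.supNorm (a.1 - b.1) ≤ Dmax := fun a ha b hb =>
    Finset.le_sup (f := fun ab : Literature.MathematicalPhysics.QuantumLattice.ZdEdge 4 ×
        Literature.MathematicalPhysics.QuantumLattice.ZdEdge 4 =>
      Literature.Probability.LatticeModels.Site.supNorm (ab.1.1 - ab.2.1)) (Finset.mk_mem_product ha hb)
  -- the torus bound along the subsequence
  set b : ℝ := 4 * (2 * Real.sqrt 2) ^ 2 * Real.exp (-(starRate ρ * ((m - 2 : ℕ) : ℝ))) *
    ((Λ₁.card : ℝ) * K₁) * ((Λ₂.card : ℝ) * K₂) with hbdef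
  have hle : |cov[F₁, F₂; μ]| ≤ b := by
    refine abs_cov_le_of_eventually_torus (fundamentalRep (Fin 2)) hμL
      (continuous_of_isLipschitzCylinder hF₁) (continuous_of_isLipschitzCylinder hF₂) hF₁.measurable
      hF₂.measurable hF₁.isCylinder hF₂.isCylinder (fun U => hF₁.abs_le U) (fun U => hF₂.abs_le U) ?_
    filter_upwards [eventually_ge_atTop (max L₁ (2 * Dmax))] with k hk
    have hkL : max L₁ (2 * Dmax) ≤ Lseq k := hk.trans hLmono.le_apply
    have hSW := hS (Lseq k + 1) (by omega)
    -- below half the period the projection is isometric on `Λ₁ ∪ Λ₂`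
    have hiso : ∀ a ∈ Λ₁ ∪ Λ₂, ∀ b ∈ Λ₁ ∪ Λ₂,
        torusNorm ((torusEdge (Lseq k + 1) a).1 - (torusEdge (Lseq k + 1) b).1) =
          Literature.Probability.LatticeModels.Site.supNorm (a.1 - b.1) := by
      intro a ha b hb
      have hlt : 2 * Literature.Probability.LatticeModels.Site.supNorm (a.1 - b.1) < Lseq k + 1 := by
        have := hDm a ha b hb; omega
      have e : (torusEdge (Lseq k + 1) a).1 - (torusEdge (Lseq k + 1) b).1 =
          Torus.proj (Lseq k + 1) (a.1 - b.1) := by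
        show Torus.proj (Lseq k + 1) a.1 - Torus.proj (Lseq k + 1) b.1 = _
        rw [sub_eq_add_neg, ← torusProj_neg_zd, ← torusProj_add_zd, ← sub_eq_add_neg]
      rw [e]
      exact torusNorm_proj_eq hlt
    have hinj : ∀ a ∈ Λ₁ ∪ Λ₂, ∀ b ∈ Λ₁ ∪ Λ₂,
        torusEdge (Lseq k + 1) a = torusEdge (Lseq k + 1) b → a = b := by
      intro a ha b hb hab
      have h1 : (torusEdge (Lseq k + 1) a).1 = (torusEdge (Lseq k + 1) b).1 := by rw [hab]
      have h2 : a.2 = b.2 := by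
        have := congrArg Prod.snd hab; exact this
      have h0 : Literature.Probability.LatticeModels.Site.supNorm (a.1 - b.1) = 0 := by
        rw [← hiso a ha b hb, h1, sub_self, torusNorm_zero]
      have h3 : a.1 = b.1 :=
        sub_eq_zero.1 (Literature.Probability.LatticeModels.Site.supNorm_eq_zero_iff.1 h0)
      exact Prod.ext h3 h2
    have hinj₁ : ∀ e ∈ Λ₁, ∀ e' ∈ Λ₁, torusEdge (Lseq k + 1) e = torusEdge (Lseq k + 1) e' → e = e' :=
      fun e he e' he' => hinj e (Finset.mem_union_left _ he) e' (Finset.mem_union_left _ he')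
    have hinj₂ : ∀ e ∈ Λ₂, ∀ e' ∈ Λ₂, torusEdge (Lseq k + 1) e = torusEdge (Lseq k + 1) e' → e = e' :=
      fun e he e' he' => hinj e (Finset.mem_union_right _ he) e' (Finset.mem_union_right _ he')
    have hgeom : ∀ a ∈ Λ₁, ∀ b ∈ Λ₂,
        m ≤ torusNorm ((torusEdge (Lseq k + 1) a).1 - (torusEdge (Lseq k + 1) b).1) := by
      intro a ha b hb
      rw [hiso a (Finset.mem_union_left _ ha) b (Finset.mem_union_right _ hb)]
      have h := setDistEdges_le_supNorm (Λ₁ := Λ₁) (Λ₂ := Λ₂) ha hb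
      rw [hm]
      exact Nat.floor_le_of_le h
    have h := su2Star_torus_cov_lipschitz βW hρ0 hρ1 hSW hF₁ hF₂ hinj₁ hinj₂ hgeom
    have hcov : cov[toTorusObservable (Lseq k + 1) F₁, toTorusObservable (Lseq k + 1) F₂;
        wilsonMeasure (d := 4) (L := Lseq k + 1) (fundamentalRep (Fin 2)) (βW / 2)] =
        (∫ V, toTorusObservable (Lseq k + 1) F₁ V * toTorusObservable (Lseq k + 1) F₂ V
            ∂(wilsonMeasure (d := 4) (L := Lseq k + 1) (fundamentalRep (Fin 2)) (βW / 2))) -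
          (∫ V, toTorusObservable (Lseq k + 1) F₁ V
            ∂(wilsonMeasure (d := 4) (L := Lseq k + 1) (fundamentalRep (Fin 2)) (βW / 2))) *
            ∫ V, toTorusObservable (Lseq k + 1) F₂ V
              ∂(wilsonMeasure (d := 4) (L := Lseq k + 1) (fundamentalRep (Fin 2)) (βW / 2)) := by
      haveI : IsProbabilityMeasure
          (wilsonMeasure (d := 4) (L := Lseq k + 1) (fundamentalRep (Fin 2)) (βW / 2)) :=
        isProbabilityMeasure_wilsonMeasure (d := 4) (L := Lseq k + 1) _ (continuous_fundamentalRep (Fin 2)) _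
      have hfo := linkObs_toTorusObservable (L := Lseq k + 1) hF₁ hinj₁
      have hgo := linkObs_toTorusObservable (L := Lseq k + 1) hF₂ hinj₂
      obtain ⟨B₁, hB₁⟩ := hfo.bounded
      obtain ⟨B₂, hB₂⟩ := hgo.bounded
      have l₁ : MemLp (toTorusObservable (Lseq k + 1) F₁) 2
          (wilsonMeasure (d := 4) (L := Lseq k + 1) (fundamentalRep (Fin 2)) (βW / 2)) :=
        memLp_of_bounded (a := -B₁) (b := B₁) (ae_of_all _ fun U => abs_le.1 (hB₁ U))
          hfo.measurable.aestronglyMeasurable 2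
      have l₂ : MemLp (toTorusObservable (Lseq k + 1) F₂) 2
          (wilsonMeasure (d := 4) (L := Lseq k + 1) (fundamentalRep (Fin 2)) (βW / 2)) :=
        memLp_of_bounded (a := -B₂) (b := B₂) (ae_of_all _ fun U => abs_le.1 (hB₂ U))
          hgo.measurable.aestronglyMeasurable 2
      exact covariance_eq_sub l₁ l₂
    rw [← hcov]
    exact h
  refine hle.trans ?_
  -- `b ≤ c₁ e^{-κ d} (K₁K₂ + …)`
  have hsd0 : 0 ≤ setDistEdges Λ₁ Λ₂ := setDistEdges_nonneg Λ₁ Λ₂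
  have hmreal : setDistEdges Λ₁ Λ₂ - 3 ≤ ((m - 2 : ℕ) : ℝ) := by
    have hfl : setDistEdges Λ₁ Λ₂ < (m : ℝ) + 1 := by
      rw [hm]; exact Nat.lt_floor_add_one _
    by_cases hm2 : 2 ≤ m
    · rw [Nat.cast_sub hm2]; push_cast; linarith
    · push Not at hm2
      have : (m : ℝ) < 2 := by exact_mod_cast hm2
      have h0 : (0 : ℝ) ≤ ((m - 2 : ℕ) : ℝ) := Nat.cast_nonneg _
      linarith
  have hexp : Real.exp (-(starRate ρ * ((m - 2 : ℕ) : ℝ))) ≤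
      Real.exp (3 * starRate ρ) * Real.exp (-starRate ρ * setDistEdges Λ₁ Λ₂) := by
    rw [← Real.exp_add]
    refine Real.exp_le_exp.2 ?_
    nlinarith
  have hn₁ : (Λ₁.card : ℝ) ≤ n := by exact_mod_cast h₁
  have hn₂ : (Λ₂.card : ℝ) ≤ n := by exact_mod_cast h₂
  have h4 : (0 : ℝ) ≤ 4 * (2 * Real.sqrt 2) ^ 2 := by positivity
  have hL2 : 0 ≤ Real.sqrt (∫ U, F₁ U ^ 2 ∂μ) * Real.sqrt (∫ U, F₂ U ^ 2 ∂μ) := by positivity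
  calc b = 4 * (2 * Real.sqrt 2) ^ 2 * Real.exp (-(starRate ρ * ((m - 2 : ℕ) : ℝ))) *
        ((Λ₁.card : ℝ) * Λ₂.card) * ((K₁ : ℝ) * K₂) := by rw [hbdef]; ring
    _ ≤ 4 * (2 * Real.sqrt 2) ^ 2 *
        (Real.exp (3 * starRate ρ) * Real.exp (-starRate ρ * setDistEdges Λ₁ Λ₂)) *
        ((n : ℝ) * n) * ((K₁ : ℝ) * K₂) := by
        have hcc : (Λ₁.card : ℝ) * Λ₂.card ≤ (n : ℝ) * n :=
          mul_le_mul hn₁ hn₂ (Nat.cast_nonneg _) (Nat.cast_nonneg _)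
        have hKK : (0 : ℝ) ≤ (K₁ : ℝ) * K₂ := mul_nonneg hK₁ hK₂
        exact mul_le_mul_of_nonneg_right
          (mul_le_mul (mul_le_mul_of_nonneg_left hexp h4) hcc (by positivity) (by positivity)) hKK
    _ = 4 * (2 * Real.sqrt 2) ^ 2 * (n : ℝ) ^ 2 * Real.exp (3 * starRate ρ) *
          Real.exp (-starRate ρ * setDistEdges Λ₁ Λ₂) * ((K₁ : ℝ) * K₂) := by ring
    _ ≤ 4 * (2 * Real.sqrt 2) ^ 2 * (n : ℝ) ^ 2 * Real.exp (3 * starRate ρ) *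
          Real.exp (-starRate ρ * setDistEdges Λ₁ Λ₂) *
          ((K₁ : ℝ) * K₂ + Real.sqrt (∫ U, F₁ U ^ 2 ∂μ) * Real.sqrt (∫ U, F₂ U ^ 2 ∂μ)) :=
        mul_le_mul_of_nonneg_left (le_add_of_nonneg_right hL2) (by positivity)

/-! ### The capstone: `MassGapAt 4 2 β` given DLR uniqueness -/

/-- **The track-(a) currency from the star window bound plus DLR uniqueness**: at 't Hooft coupling
`β` (Wilson `β_W = 4β`, tree coupling `2β`), if every torus of side `L ≥ L₁` carries
`StarWindowBound L (4β) ρ suFrobDist` with `ρ < 1` and the DLR state of the `ℤ⁴` specification is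
unique (`HasUniqueGibbsMeasure`, route X of the cell — a HYPOTHESIS here), then
`Summit.Ventures.YMGap.MassGapAt 4 2 β` holds (uniqueness + the Shen–Zhu–Zhu covariance clause for
every DLR state): the unique DLR state is an infinite-volume limit point
(`infiniteVolumeLimitPoints_nonempty_holds`, `mem_ymGibbsMeasures_of_mem_infiniteVolumeLimitPoints_holds`)
and `su2Star_limitState_clustering` applies. -/
theorem su2Star_massGapAt_of_unique (β : ℝ) {ρ : ℝ} (hρ0 : 0 ≤ ρ) (hρ1 : ρ < 1) (L₁ : ℕ)
    (hS : ∀ (L : ℕ) [NeZero L], L₁ ≤ L → StarWindowBound L (4 * β) ρ suFrobDist)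
    (huniq : HasUniqueGibbsMeasure (ymSpecification (d := 4) (fundamentalRep (Fin 2)) (2 * β))) :
    MassGapAt 4 2 β := by
  haveI : SecondCountableTopology (Matrix (Fin 2) (Fin 2) ℂ) :=
    inferInstanceAs (SecondCountableTopology (Fin 2 → Fin 2 → ℂ))
  haveI : SecondCountableTopology (Matrix.specialUnitaryGroup (Fin 2) ℂ) :=
    Topology.IsEmbedding.subtypeVal.secondCountableTopology
  have huniq' : HasUniqueGibbsMeasure
      (ymSpecification (d := 4) (fundamentalRep (Fin 2)) ((2 : ℕ) * β)) := by
    exact_mod_cast huniq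
  refine ⟨huniq', fun μ hμ => ?_⟩
  have hρc := continuous_fundamentalRep (Fin 2)
  -- the unique DLR state is a limit point of the torus states at tree coupling `2β = (4β)/2`
  obtain ⟨ν, hν⟩ := infiniteVolumeLimitPoints_nonempty_holds (d := 4) (fundamentalRep (Fin 2)) hρc
    ((2 : ℕ) * β)
  have hνG : ν ∈ ymGibbsMeasures (d := 4) (fundamentalRep (Fin 2)) ((2 : ℕ) * β) :=
    mem_ymGibbsMeasures_of_mem_infiniteVolumeLimitPoints_holds (d := 4) (fundamentalRep (Fin 2)) hρc hν
  have hμν : μ = ν := huniq'.1 hμ hνG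
  have hμlim : μ ∈ infiniteVolumeLimitPoints (d := 4) (fundamentalRep (Fin 2)) (4 * β / 2) := by
    rw [hμν, show (4 : ℝ) * β / 2 = (2 : ℕ) * β by push_cast; ring]; exact hν
  refine ⟨starRate ρ, starRate_pos hρ0 hρ1, fun n => ?_⟩
  obtain ⟨c₁, hc₁⟩ := su2Star_limitState_clustering (4 * β) hρ0 hρ1 L₁ hS μ hμlim n
  exact ⟨c₁, fun F₁ F₂ Λ₁ Λ₂ K₁ K₂ h₁ h₂ hd hF₁ hF₂ => hc₁ F₁ F₂ Λ₁ Λ₂ K₁ K₂ h₁ h₂ hd hF₁ hF₂⟩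

/-- **Lemma-G form of the capstone** (the `StarWindowBound` hypothesis is literally the binder of ds-1's
`DSWindow.su2_strongCouplingFront_of_lemmaG`, discharged by ds-4's `starWindowBound_lemmaG` for
`β_W ≤ 1/2`): at every 't Hooft coupling `0 ≤ β ≤ β₀/4` with `β₀ ≤ 7/10` and `R_G(β₀) < 1`,
DLR uniqueness implies `MassGapAt 4 2 β`. -/
theorem su2_massGapAt_of_lemmaG_of_unique (β₀ : ℝ) (h0 : 0 ≤ β₀) (h7 : β₀ ≤ 7 / 10)
    (hρ : gaugeR β₀ < 1)
    (hG : ∀ (L : ℕ) [NeZero L], 3 ≤ L → ∀ βW : ℝ, 0 ≤ βW → βW ≤ β₀ →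
      StarWindowBound L βW (gaugeR βW) suFrobDist)
    {β : ℝ} (hβ0 : 0 ≤ β) (hβ1 : 4 * β ≤ β₀)
    (huniq : HasUniqueGibbsMeasure (ymSpecification (d := 4) (fundamentalRep (Fin 2)) (2 * β))) :
    MassGapAt 4 2 β := by
  have hρ0 : 0 ≤ gaugeR β₀ := by
    have hΔ := StarWindowGauge.Delta_pos (c := β₀ / 4) (by linarith) (by linarith)
    unfold gaugeR
    positivity
  refine su2Star_massGapAt_of_unique β hρ0 hρ 3 (fun L _ hL => ?_) huniq
  obtain ⟨K, hK, hKloc, hcontract, hsum⟩ := hG L hL (4 * β) (by linarith) hβ1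
  exact ⟨K, hK, hKloc, hcontract, fun s y hy =>
    (hsum s y hy).trans (gaugeR_mono (by linarith) hβ1 h7)⟩

/-- **The `9/100` row**: given Lemma G on all tori of side `≥ 3` up to `β_W = 9/25` and DLR uniqueness
at 't Hooft coupling `β ∈ [0, 9/100]` (Wilson `β_W = 4β ≤ 9/25`), `MassGapAt 4 2 β` — to be compared
with the track-(a) window `|β| < 1/32` (`HessianSharp.improvedThreshold_dim4`, K-conditional on three
named printed facts) and the printed `1/48`. -/
theorem su2_massGapAt_le_9_100_of_lemmaG_of_unique
    (hG : ∀ (L : ℕ) [NeZero L], 3 ≤ L → ∀ βW : ℝ, 0 ≤ βW → βW ≤ 9 / 25 →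
      StarWindowBound L βW (gaugeR βW) suFrobDist)
    {β : ℝ} (hβ0 : 0 ≤ β) (hβ1 : β ≤ 9 / 100)
    (huniq : HasUniqueGibbsMeasure (ymSpecification (d := 4) (fundamentalRep (Fin 2)) (2 * β))) :
    MassGapAt 4 2 β :=
  su2_massGapAt_of_lemmaG_of_unique (9 / 25) (by norm_num) (by norm_num)
    (StarWindowGauge.gaugeR_lt_one_of_le (by norm_num) le_rfl) hG hβ0 (by linarith) huniq

end Limit

end Summit.Ventures.YMGap.StarLimit

end
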